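import Summits.MatrixMultiplication.OmegaCensus.DominoZpZpCover
import HarnessLib

/-!
# Scaling-canonical certified tables for the `ℤ_p × ℤ_p` domino covers (generic in `p`)

ω-census `pub-omega`, family (b3), seat pub-omega-group gen 20.  Framing: lottery ticket; floor = certified bounds/negative
ranges.  VALUE: lets the certified 1-D line tables of the larger primes (`p = 11, 13, 17, 19, …`) be stored UP TO UNIT
SCALING `v ↦ k·v` of `ZMod p` (a factor `≈ p − 1` fewer entries); NOT progress on ω.

The kernel cover programs of `DominoZpZpEnum.lean` are unchanged (they only consult the search tree of the UNcertified
codes, a scaling-closed set).  What changes is the table-soundness check: `soundChkS` verifies, for every composition `c` of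
`d` not flagged by the pass tree, that the code of its canonical scaling `nfVec p c` (`nfVec p c [w] = c [(v₀·w) % p]`, pivot
`v₀ = nfPivot p c ∈ [1, p−1]`) is a key of the search tree `tabTree` BUILT FROM the canonical table `T` — membership in a tree
built from a list implies membership in the list with NO ordering invariant (`BTree.mem_build`), and `polyBE` is
injective on well-formed digit lists (`tabWF`).  `sound_of_soundChkS` (needs `p` prime for the inverse scaling, Fermat) and
`exists_entry_of_cover_scaled` produce the SCALED cover hypothesis consumed by `DominoZpZpCells.lean`.
-/

namespace Summit.MatrixMultiplication.OmegaCensus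

open Finset

namespace ZpZpDomino

/-! ## Search trees: membership implies insertion (no invariant) -/

/-- The keys stored in a tree. [folklore] -/
def BTree.keys : BTree → List ℕ
  | .nil => []
  | .node l k r => k :: (l.keys ++ r.keys)

/-- A successful search finds a stored key (true for ANY tree, ordered or not). [folklore] -/
theorem BTree.mem_imp_keys : ∀ (t : BTree) (x : ℕ), t.mem x = true → x ∈ t.keys
  | .nil, x, h => by simp [BTree.mem] at h
  | .node l k r, x, h => by
    unfold BTree.mem at h
    simp only [BTree.keys, List.mem_cons, List.mem_append]
    split_ifs at h with h1 h2
    · exact Or.inr (Or.inl (BTree.mem_imp_keys l x h))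
    · exact Or.inr (Or.inr (BTree.mem_imp_keys r x h))
    · left; omega

/-- Insertion adds at most the inserted key. [folklore] -/
theorem BTree.keys_insert : ∀ (t : BTree) (y x : ℕ), x ∈ (t.insert y).keys → x = y ∨ x ∈ t.keys
  | .nil, y, x, h => by
    simp only [BTree.insert, BTree.keys, List.append_nil, List.mem_singleton] at h
    exact Or.inl h
  | .node l k r, y, x, h => by
    unfold BTree.insert at h
    split_ifs at h with h1 h2
    · simp only [BTree.keys, List.mem_cons, List.mem_append] at h ⊢
      rcases h with h | h | h
      · exact Or.inr (Or.inl h)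
      · rcases BTree.keys_insert l y x h with h' | h'
        · exact Or.inl h'
        · exact Or.inr (Or.inr (Or.inl h'))
      · exact Or.inr (Or.inr (Or.inr h))
    · simp only [BTree.keys, List.mem_cons, List.mem_append] at h ⊢
      rcases h with h | h | h
      · exact Or.inr (Or.inl h)
      · exact Or.inr (Or.inr (Or.inl h))
      · rcases BTree.keys_insert r y x h with h' | h'
        · exact Or.inl h'
        · exact Or.inr (Or.inr (Or.inr h'))
    · exact Or.inr h

/-- **Membership in `BTree.ofList l` implies membership in `l`** (no ordering invariant needed). [folklore] -/
theorem BTree.mem_ofList {l : List ℕ} {x : ℕ} (h : (BTree.ofList l).mem x = true) : x ∈ l := by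
  have key : ∀ (l : List ℕ) (t : BTree), x ∈ (l.foldl BTree.insert t).keys → x ∈ l ∨ x ∈ t.keys := by
    intro l
    induction l with
    | nil => intro t h; exact Or.inr h
    | cons y l ih =>
      intro t h
      simp only [List.foldl_cons] at h
      rcases ih _ h with h' | h'
      · exact Or.inl (List.mem_cons_of_mem _ h')
      · rcases BTree.keys_insert t y x h' with h'' | h''
        · exact Or.inl (h'' ▸ List.mem_cons_self)
        · exact Or.inr h''
  rcases key l .nil (BTree.mem_imp_keys _ _ h) with h' | h'
  · exact h'
  · simp [BTree.keys] at h'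

/-- Balanced search tree of a list of (nominal) length `len` (fuel `n` bounds the depth; meant for lists sorted
increasingly, but membership soundness below holds for ANY list and ANY `len`).  Preferred over `BTree.ofList` for long
lists: no `List.length`, no insertion chain — the kernel evaluates it with recursion depth `O(log len)`. [folklore] -/
def BTree.build : ℕ → ℕ → List ℕ → BTree
  | 0, _, _ => .nil
  | n + 1, len, l =>
    match l.drop (len / 2) with
    | [] => .nil
    | k :: rest => .node (BTree.build n (len / 2) (l.take (len / 2))) k (BTree.build n (len - len / 2 - 1) rest)

/-- The keys of `BTree.build n len l` lie in `l`. [folklore] -/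
theorem BTree.keys_build : ∀ (n len : ℕ) (l : List ℕ) (x : ℕ), x ∈ (BTree.build n len l).keys → x ∈ l
  | 0, len, l, x, h => by simp [BTree.build, BTree.keys] at h
  | n + 1, len, l, x, h => by
    rw [BTree.build] at h
    split at h
    · simp [BTree.keys] at h
    · rename_i k rest hdrop
      have hsub : ∀ y, y ∈ k :: rest → y ∈ l := fun y hy => List.mem_of_mem_drop (hdrop ▸ hy)
      simp only [BTree.keys, List.mem_cons, List.mem_append] at h
      rcases h with hk | hk | hk
      · exact hsub _ (hk ▸ List.mem_cons_self)
      · exact List.mem_of_mem_take (BTree.keys_build n _ _ x hk)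
      · exact hsub _ (List.mem_cons_of_mem _ (BTree.keys_build n _ _ x hk))

/-- **Membership in `BTree.build n len l` implies membership in `l`** (no ordering invariant needed). [folklore] -/
theorem BTree.mem_build {n len : ℕ} {l : List ℕ} {x : ℕ} (h : (BTree.build n len l).mem x = true) : x ∈ l :=
  BTree.keys_build n len l x (BTree.mem_imp_keys _ _ h)

/-! ## Compositions: soundness of `compsLB` -/

/-- Members of `compsLB lb n r` have length `n` and sum `r`. [folklore] -/
theorem of_mem_compsLB : ∀ (lb : List ℕ) (n r : ℕ) (l : List ℕ), l ∈ compsLB lb n r → l.length = n ∧ l.sum = r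
  | lb, 0, r, l, h => by
    unfold compsLB at h
    split_ifs at h with hr
    · simp only [List.mem_singleton] at h
      subst h; subst hr; simp
    · simp at h
  | lb, n + 1, r, l, h => by
    simp only [compsLB, List.mem_flatMap, List.mem_range, List.mem_map] at h
    obtain ⟨c, hc, l', hl', rfl⟩ := h
    obtain ⟨hlen, hsum⟩ := of_mem_compsLB lb.tail n _ l' hl'
    refine ⟨by simp [hlen], ?_⟩
    simp only [List.sum_cons, hsum]
    omega

/-- An entry of a list of naturals is at most the sum. [folklore] -/
theorem getD_le_sum (l : List ℕ) (i : ℕ) : l.getD i 0 ≤ l.sum := by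
  rw [List.getD_eq_getElem?_getD]
  by_cases hi : i < l.length
  · rw [List.getElem?_eq_getElem hi, Option.getD_some]
    exact List.le_sum_of_mem (List.getElem_mem hi)
  · rw [List.getElem?_eq_none_iff.2 (by omega), Option.getD_none]
    exact Nat.zero_le _

/-! ## Canonical scalings -/

/-- Maximum of a list of naturals (accumulator version: every comparison is between evaluated numerals, so the kernel
never builds a chain of pending `max`es). [folklore] -/
def listMax : List ℕ → ℕ → ℕ
  | [], m => m
  | x :: xs, m => if m < x then listMax xs x else listMax xs m

/-- The pivot, given the maximum `m` of `c[1], …, c[p−1]`: the first position `≥ 1` carrying it (`1` if none). [folklore] -/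
def nfPivotAux (p : ℕ) (c : List ℕ) (m : ℕ) : ℕ := ((List.range (p - 1)).find? fun i => c.getD (i + 1) 0 == m).getD 0 + 1

/-- The pivot position `v₀ ∈ [1, p − 1]`: the first position `≥ 1` carrying the maximum of `c[1], …, c[p−1]`. [folklore] -/
def nfPivot (p : ℕ) (c : List ℕ) : ℕ := nfPivotAux p c (listMax (c.drop 1) 0)

/-- The scaling by a given pivot: `w ↦ c [(v₀·w) % p]`. [folklore] -/
def nfVecAux (p : ℕ) (c : List ℕ) (v₀ : ℕ) : List ℕ := (List.range p).map fun w => c.getD (v₀ * w % p) 0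

/-- The canonical scaling `nfVec p c [w] = c [(v₀·w) % p]`, `v₀ = nfPivot p c`. [folklore] -/
def nfVec (p : ℕ) (c : List ℕ) : List ℕ := nfVecAux p c (nfPivot p c)

/-- The pivot lies in `[1, p − 1]` (for `p ≥ 2`). [folklore] -/
theorem nfPivot_pos (p : ℕ) (c : List ℕ) : 1 ≤ nfPivot p c := by
  unfold nfPivot nfPivotAux; exact Nat.le_add_left 1 _

/-- The pivot lies in `[1, p − 1]` (for `p ≥ 2`). [folklore] -/
theorem nfPivot_lt {p : ℕ} (hp : 2 ≤ p) (c : List ℕ) : nfPivot p c < p := by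
  unfold nfPivot nfPivotAux
  generalize listMax (c.drop 1) 0 = m
  cases hf : (List.range (p - 1)).find? (fun i => c.getD (i + 1) 0 == m) with
  | none => simp; omega
  | some i =>
    have hi := List.mem_range.1 (List.mem_of_find?_eq_some hf)
    simp; omega

/-- Length of `nfVec`. [folklore] -/
@[simp] theorem length_nfVec (p : ℕ) (c : List ℕ) : (nfVec p c).length = p := by simp [nfVec, nfVecAux]

/-- Entries of `nfVec`. [folklore] -/
theorem getD_nfVec (p : ℕ) (c : List ℕ) {w : ℕ} (hw : w < p) :
    (nfVec p c).getD w 0 = c.getD (nfPivot p c * w % p) 0 := by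
  simp [nfVec, nfVecAux, List.getD_eq_getElem?_getD, List.getElem?_range hw]

/-! ## Kernel-strict helpers: compositions with numeral entries, strict Horner evaluation -/

/-- All lists of `n` naturals with sum `r` (no lower bounds; every member is a list of numerals when evaluated by the
kernel, unlike the members of `compsLB`, whose entries are pending sums). [folklore] -/
def compsLit : ℕ → ℕ → List (List ℕ)
  | 0, r => if r = 0 then [[]] else []
  | n + 1, r => (List.range (r + 1)).flatMap fun c => (compsLit n (r - c)).map fun l => c :: l

/-- **Completeness of `compsLit`.** [folklore] -/
theorem mem_compsLit : ∀ (n r : ℕ) (l : List ℕ), l.length = n → l.sum = r → l ∈ compsLit n r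
  | 0, r, l, hl, hs => by
    have hl' : l = [] := List.eq_nil_of_length_eq_zero hl
    subst hl'
    simp only [List.sum_nil] at hs
    subst hs
    simp [compsLit]
  | n + 1, r, l, hl, hs => by
    obtain ⟨a, l', rfl⟩ := List.exists_cons_of_length_eq_add_one hl
    simp only [List.length_cons, Nat.add_right_cancel_iff] at hl
    simp only [List.sum_cons] at hs
    simp only [compsLit, List.mem_flatMap, List.mem_range, List.mem_map]
    exact ⟨a, by omega, l', mem_compsLit n _ l' hl (by omega), rfl⟩

/-- Strict Horner evaluation `hornerS B l acc = acc·B^|l| + polyBE B l`: the `match` on the running value makes the kernel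
evaluate it to a numeral at every step (no chain of pending additions, no `List.length`). [folklore] -/
def hornerS (B : ℕ) : List ℕ → ℕ → ℕ
  | [], acc => acc
  | c :: l, acc =>
    match acc * B + c with
    | 0 => hornerS B l 0
    | k + 1 => hornerS B l (k + 1)

/-- `hornerS` computes `polyBE`. [folklore] -/
theorem hornerS_eq (B : ℕ) : ∀ (l : List ℕ) (acc : ℕ), hornerS B l acc = acc * B ^ l.length + polyBE B l
  | [], acc => by simp [hornerS, polyBE]
  | c :: l, acc => by
    have key : hornerS B (c :: l) acc = hornerS B l (acc * B + c) := by
      rw [hornerS]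
      cases h : acc * B + c <;> rfl
    rw [key, hornerS_eq B l, polyBE, List.length_cons, pow_succ]
    ring

/-- `hornerS B l 0 = polyBE B l`. [folklore] -/
theorem hornerS_zero (B : ℕ) (l : List ℕ) : hornerS B l 0 = polyBE B l := by
  rw [hornerS_eq]; simp

/-! ## The scaled soundness check -/

/-- Well-formed table keys: length `p`, digits `< B`. [folklore] -/
def tabWF (p B : ℕ) (T : List (List ℕ × List (ℕ × List ℕ))) : Bool :=
  T.all fun e => e.1.length == p && e.1.all fun x => decide (x < B)

/-- The search tree of the codes of the table keys, for a table of `len` entries listed in INCREASING code order (balanced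
build, kernel recursion depth `O(log len)`). [folklore] -/
def tabTree (B len : ℕ) (T : List (List ℕ × List (ℕ × List ℕ))) : BTree := BTree.build 64 len (T.map fun e => polyBE B e.1)

/-- The search tree of the codes of the table keys, by successive insertion (any order; kernel recursion depth `|T|`, so
only for tables of at most a few hundred entries). [folklore] -/
def tabTreeI (B : ℕ) (T : List (List ℕ × List (ℕ × List ℕ))) : BTree := BTree.ofList (T.map fun e => polyBE B e.1)

/-- Keys found in `tabTree` are table codes. [folklore] -/
theorem mem_tabTree {B len : ℕ} {T : List (List ℕ × List (ℕ × List ℕ))} {x : ℕ} (h : (tabTree B len T).mem x = true) :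
    x ∈ T.map fun e => polyBE B e.1 :=
  BTree.mem_build h

/-- Keys found in `tabTreeI` are table codes. [folklore] -/
theorem mem_tabTreeI {B : ℕ} {T : List (List ℕ × List (ℕ × List ℕ))} {x : ℕ} (h : (tabTreeI B T).mem x = true) :
    x ∈ T.map fun e => polyBE B e.1 :=
  BTree.mem_ofList h

/-- **Scaled table soundness check** (a `Bool`): the keys are well formed and every composition of `d` into `p` parts not
flagged by `tree` has the code of its canonical scaling in the search tree `tt` of the table codes (`tabTree`/`tabTreeI`,
passed as a top-level constant so that the kernel evaluates it once). [folklore] -/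
def soundChkS (p d : ℕ) (tree tt : BTree) (T : List (List ℕ × List (ℕ × List ℕ))) : Bool :=
  tabWF p (d + 1) T &&
    (compsLit p d).all fun c => tree.mem (hornerS (d + 1) c 0) || tt.mem (hornerS (d + 1) (nfVec p c) 0)

/-- The per-composition core of the scaled soundness: if `c` (a composition of `d`, unflagged by `tree`) passes the
membership test against the table tree, it has a table entry up to scaling. [folklore] -/
theorem sound_core {p d : ℕ} (hp : p.Prime) {tree tt : BTree} {T : List (List ℕ × List (ℕ × List ℕ))}
    (htt : ∀ x, tt.mem x = true → x ∈ T.map fun e => polyBE (d + 1) e.1) (hWF : tabWF p (d + 1) T = true)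
    (c : List ℕ) (hc : c ∈ compsLB [] p d)
    (h1 : (tree.mem (hornerS (d + 1) c 0) || tt.mem (hornerS (d + 1) (nfVec p c) 0)) = true)
    (hm : tree.mem (polyBE (d + 1) c) = false) :
    ∃ k : ℕ, k % p ≠ 0 ∧ ∃ e ∈ T, ∀ v < p, e.1.getD (k * v % p) 0 = c.getD v 0 := by
  have hp2 : 2 ≤ p := hp.two_le
  obtain ⟨hclen, hcsum⟩ := of_mem_compsLB [] p d c hc
  rw [hornerS_zero, hornerS_zero, hm, Bool.false_or] at h1
  -- the table entry
  have h2 := htt _ h1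
  rw [List.mem_map] at h2
  obtain ⟨e, he, hcode⟩ := h2
  simp only [tabWF, List.all_eq_true, Bool.and_eq_true, beq_iff_eq, decide_eq_true_eq] at hWF
  obtain ⟨helen, hedig⟩ := hWF e he
  have hnf : e.1 = nfVec p c := by
    refine polyBE_inj (by rw [helen, length_nfVec]) hedig (fun x hx => ?_) hcode
    simp only [nfVec, nfVecAux, List.mem_map, List.mem_range] at hx
    obtain ⟨w, -, rfl⟩ := hx
    exact Nat.lt_succ_of_le (hcsum ▸ getD_le_sum c _)
  -- the inverse of the pivot
  set v₀ := nfPivot p c with hv₀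
  have hv₀p : 1 ≤ v₀ := nfPivot_pos p c
  have hv₀l : v₀ < p := nfPivot_lt hp2 c
  haveI : Fact p.Prime := ⟨hp⟩
  have hz : ((v₀ : ℕ) : ZMod p) ≠ 0 := by
    rw [ne_eq, ZMod.natCast_eq_zero_iff]
    exact fun hdvd => absurd (Nat.le_of_dvd (by omega) hdvd) (by omega)
  have hferm : ((v₀ : ℕ) : ZMod p) ^ (p - 1) = 1 := ZMod.pow_card_sub_one_eq_one hz
  set k := v₀ ^ (p - 2) % p with hk
  have hkv : v₀ * k % p = 1 := by
    have e1 : ((v₀ * k % p : ℕ) : ZMod p) = ((1 : ℕ) : ZMod p) := by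
      rw [hk, Nat.mul_mod, Nat.mod_mod, ← Nat.mul_mod, ← pow_succ', show p - 2 + 1 = p - 1 by omega,
        ZMod.natCast_mod, Nat.cast_pow, hferm, Nat.cast_one]
    have e2 := (ZMod.natCast_eq_natCast_iff' _ _ p).1 e1
    rwa [Nat.mod_mod, Nat.mod_eq_of_lt hp.one_lt] at e2
  refine ⟨k, fun hk0 => ?_, e, he, fun v hv => ?_⟩
  · rw [Nat.mul_mod, hk0, mul_zero, Nat.zero_mod] at hkv
    exact zero_ne_one hkv
  · rw [hnf, getD_nfVec p c (Nat.mod_lt _ (by omega)), ← hv₀]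
    congr 1
    rw [Nat.mul_mod, Nat.mod_mod, ← Nat.mul_mod, ← mul_assoc, Nat.mul_mod, hkv, one_mul, Nat.mod_mod,
      Nat.mod_eq_of_lt hv]

/-- **From the scaled check to the scaled table hypothesis**: a composition `c` of `d` whose code is unflagged has a table
entry `e` and a unit `k` of `ZMod p` with `e.1[(k·v) % p] = c[v]` for all `v < p`. [folklore] -/
theorem sound_of_soundChkS {p d : ℕ} (hp : p.Prime) {tree tt : BTree} {T : List (List ℕ × List (ℕ × List ℕ))}
    (htt : ∀ x, tt.mem x = true → x ∈ T.map fun e => polyBE (d + 1) e.1) (h : soundChkS p d tree tt T = true) :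
    ∀ c ∈ compsLB [] p d, tree.mem (polyBE (d + 1) c) = false →
      ∃ k : ℕ, k % p ≠ 0 ∧ ∃ e ∈ T, ∀ v < p, e.1.getD (k * v % p) 0 = c.getD v 0 := by
  intro c hc hm
  simp only [soundChkS, Bool.and_eq_true, List.all_eq_true] at h
  obtain ⟨hWF, hall⟩ := h
  obtain ⟨hclen, hcsum⟩ := of_mem_compsLB [] p d c hc
  exact sound_core hp htt hWF c hc (hall c (mem_compsLit p d c hclen hcsum)) hm

/-- **From the cover programs and a scaled table hypothesis (however obtained) to the SCALED semantic statement.**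
[folklore] -/
theorem exists_entry_of_cover_scaledH {p : ℕ} [NeZero p] (hp : p.Prime) {d : ℕ}
    (T : List (List ℕ × List (ℕ × List ℕ))) (tree : BTree)
    (hT : ∀ c ∈ compsLB [] p d, tree.mem (polyBE (d + 1) c) = false →
      ∃ k : ℕ, k % p ≠ 0 ∧ ∃ e ∈ T, ∀ v < p, e.1.getD (k * v % p) 0 = c.getD v 0)
    {K m : ℕ} (hm : 0 < m) (h1 : ∀ k < m, coverNF1 p d tree K m k = true) (h2 : coverNF2 p d tree = true)
    (h3 : coverNF3 p d tree = true) (i10 i01 : Fin (p * p)) (h10 : i10.val = p) (h01 : i01.val = 1)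
    (g : Fin (p * p) → ℕ) (hg : ∑ i, g i = d)
    (hNF : (1 ≤ g i10 ∧ 1 ≤ g i01) ∨ (1 ≤ g i10 ∧ ∀ i : Fin (p * p), i.val % p ≠ 0 → g i = 0) ∨
      (∀ i : Fin (p * p), i.val ≠ 0 → g i = 0)) :
    ∃ j < p + 1, ∃ k : ℕ, k % p ≠ 0 ∧ ∃ e ∈ T, ∀ v < p,
      e.1.getD (k * v % p) 0 = ∑ i : Fin (p * p), pick v (pv p j i.val) (g i) := by
  obtain ⟨j, hj, hmem⟩ := exists_unflagged_of_cover hp.two_le tree hm h1 h2 h3 i10 i01 h10 h01 g hg hNF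
  obtain ⟨k, hk, e, he, hev⟩ := hT _ (hg ▸ cnts_mem_compsLB j g) hmem
  refine ⟨j, hj, k, hk, e, he, fun v hv => ?_⟩
  rw [hev v hv, cnts, Literature.Computability.Complexity.getD_ofFn _ _ hv]

/-- **From the cover programs to the SCALED semantic statement** (canonical tables). [folklore] -/
theorem exists_entry_of_cover_scaled {p : ℕ} [NeZero p] (hp : p.Prime) {d : ℕ}
    (T : List (List ℕ × List (ℕ × List ℕ))) (tree tt : BTree)
    (htt : ∀ x, tt.mem x = true → x ∈ T.map fun e => polyBE (d + 1) e.1) (hT : soundChkS p d tree tt T = true)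
    {K m : ℕ} (hm : 0 < m) (h1 : ∀ k < m, coverNF1 p d tree K m k = true) (h2 : coverNF2 p d tree = true)
    (h3 : coverNF3 p d tree = true) (i10 i01 : Fin (p * p)) (h10 : i10.val = p) (h01 : i01.val = 1)
    (g : Fin (p * p) → ℕ) (hg : ∑ i, g i = d)
    (hNF : (1 ≤ g i10 ∧ 1 ≤ g i01) ∨ (1 ≤ g i10 ∧ ∀ i : Fin (p * p), i.val % p ≠ 0 → g i = 0) ∨
      (∀ i : Fin (p * p), i.val ≠ 0 → g i = 0)) :
    ∃ j < p + 1, ∃ k : ℕ, k % p ≠ 0 ∧ ∃ e ∈ T, ∀ v < p,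
      e.1.getD (k * v % p) 0 = ∑ i : Fin (p * p), pick v (pv p j i.val) (g i) := by
  obtain ⟨j, hj, hmem⟩ := exists_unflagged_of_cover hp.two_le tree hm h1 h2 h3 i10 i01 h10 h01 g hg hNF
  obtain ⟨k, hk, e, he, hev⟩ := sound_of_soundChkS hp htt hT _ (hg ▸ cnts_mem_compsLB j g) hmem
  refine ⟨j, hj, k, hk, e, he, fun v hv => ?_⟩
  rw [hev v hv, cnts, Literature.Computability.Complexity.getD_ofFn _ _ hv]

end ZpZpDomino

end Summit.MatrixMultiplication.OmegaCensus
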